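import Summits.AnomalousDissipation.AnomalousDissipation.Theorems.SolenoidalFractalHomogenisationLagrangianCarrierConstructionTowerStepExplicit
import Summits.AnomalousDissipation.AnomalousDissipation.Theorems.SolenoidalFractalHomogenisationLagrangianCarrierConstructionTowerDet
import Summits.AnomalousDissipation.AnomalousDissipation.Theorems.SolenoidalFractalHomogenisationLagrangianCarrierConstructionTowerPeriodic
import Summits.AnomalousDissipation.AnomalousDissipation.Theorems.SolenoidalFractalHomogenisationPermissibleFractalCarrierTime
import Literature.Analysis.FluidPDE.LagrangianLatticeCarrier
import HarnessLib

/-!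
# K3L `LagrangianCarrierConstruction` (stmt-AnomalousDissipation-24913), line `birth`: the LAGRANGIAN TOWER as one existence statement
# (helper; `--supports stmt-AnomalousDissipation-24913`)

Summits-side helper file (everything proved; no definitions, no named facts). `exists_tower` packages the construction that the
assemblies `…FlowsL`, `…FlowsLSmooth`, `…FlowsLVolume`, `…FlowsLPeriodic` each rebuilt inline: over a Lagrangian lattice carrier datum
`E` with commensurable refresh windows (W1), (W2) there are, for every level `m`, an absolute flow `A m t : ℝ³ ≃ ℝ³`, its
velocity `Bs m` and a countable break set `Ds m` with `Bs 0 = 0`, `Bs (m+1) = Bs m + (inserted lifted Eulerian level m+1 over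
A m)`, and for every `m` the tower INVARIANT (lattice equivariance; one-sided closed-slab joint `C^n` regularity of `(t,z) ↦ A m t z`
and of the inverses for every `n ≥ 1`; two-sided off `Ds m`; the flow equation `∂ₜ A m t z = Bs m t (A m t z)` off `Ds m`;
periodicity / local boundedness / continuity of `Bs m`; local derivative bounds), unit Jacobians of `A m t` and `(A m t)⁻¹`
(Liouville), and the time periodicity `A m (t+T) ∘ (A m (s+T))⁻¹ = A m t ∘ (A m s)⁻¹`, `T = refresh 1`, of the relative flows and
of the inserted velocities. Built by `Nat.rec` from `…TowerStepExplicit.tower_step_explicit`, `…TowerDet`, `…TowerPeriodic`.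
Infrastructure for route-1's rung leaf F-D1.A0 (a frontier FORMAL rung); NOT a proof of anomalous dissipation.
-/

set_option linter.dupNamespace false

noncomputable section

namespace Summit.AnomalousDissipation.AnomalousDissipation.Theorems.SolenoidalFractalHomogenisation.LagrangianCarrierConstruction

open Set Function Filter Topology Metric MeasureTheory
open scoped NNReal
open Literature.Analysis Literature.Analysis.ODE Literature.Analysis.FunctionSpaces Literature.Analysis.FunctionSpaces.Torus
open Literature.Analysis.FluidPDE Literature.Analysis.FluidPDE.LatticeShear

variable {k : ℕ}

/-- **The Lagrangian tower.** See the module docstring; the second conjunct spells out the inserted velocity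
`D(A t ∘ A(w)⁻¹)(A w ((A t)⁻¹ z)) · level (m+1) t (proj (A w ((A t)⁻¹ z)))`, `w = ⌊t/refresh (m+1)⌋ · refresh (m+1)`.
[cite: ArmstrongVicol2025, §2.2 (PDF pp. 12, 18: the flows X_m and the insertion b_m = b_{m−1} + Σ_l 𝟙 v_m(t, X_{m−1}^{-1}))] -/
theorem exists_tower (E : LagrangianLatticeCarrier k)
    (hW1 : ∀ m, ∃ r : ℕ, 0 < r ∧ E.refresh (m + 1) = (r : ℝ) * E.toFractalCarrierData.physPeriod (m + 1))
    (hW2 : ∀ m, ∃ q : ℕ, 0 < q ∧ E.refresh m = (q : ℝ) * E.refresh (m + 1)) :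
    ∃ (A : ℕ → ℝ → EuclideanSpace ℝ (Fin 3) ≃ EuclideanSpace ℝ (Fin 3))
      (Bs : ℕ → ℝ → EuclideanSpace ℝ (Fin 3) → EuclideanSpace ℝ (Fin 3)) (Ds : ℕ → Set ℝ),
      Bs 0 = (fun _ _ => 0) ∧
      (∀ m, Bs (m + 1) = fun t z => Bs m t z +
        fderiv ℝ (fun y => A m t ((A m ((⌊t / E.refresh (m + 1)⌋ : ℝ) * E.refresh (m + 1))).symm y))
          (A m ((⌊t / E.refresh (m + 1)⌋ : ℝ) * E.refresh (m + 1)) ((A m t).symm z))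
          (E.toFractalCarrierData.level (m + 1) t
            (proj (A m ((⌊t / E.refresh (m + 1)⌋ : ℝ) * E.refresh (m + 1)) ((A m t).symm z))))) ∧
      (∀ m,
        (∀ t z (n : Fin 3 → ℤ), A m t (z + latticeVec n) = A m t z + latticeVec n) ∧
        (∀ (n : ℕ), 1 ≤ n → ∀ r, ∃ ε > 0, ContDiffOn ℝ n (fun p : ℝ × EuclideanSpace ℝ (Fin 3) => A m p.1 p.2) (Icc r (r + ε) ×ˢ univ) ∧
          ContDiffOn ℝ n (fun p : ℝ × EuclideanSpace ℝ (Fin 3) => A m p.1 p.2) (Icc (r - ε) r ×ˢ univ)) ∧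
        (∀ (n : ℕ), 1 ≤ n → ∀ r, ∃ ε > 0, ContDiffOn ℝ n (fun p : ℝ × EuclideanSpace ℝ (Fin 3) => (A m p.1).symm p.2)
          (Icc r (r + ε) ×ˢ univ) ∧
          ContDiffOn ℝ n (fun p : ℝ × EuclideanSpace ℝ (Fin 3) => (A m p.1).symm p.2) (Icc (r - ε) r ×ˢ univ)) ∧
        (Ds m).Countable ∧
        (∀ (n : ℕ), 1 ≤ n → ∀ t ∉ Ds m, ∃ ε > 0, ContDiffOn ℝ n (fun p : ℝ × EuclideanSpace ℝ (Fin 3) => A m p.1 p.2)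
          (Icc (t - ε) (t + ε) ×ˢ univ)) ∧
        (∀ (n : ℕ), 1 ≤ n → ∀ t ∉ Ds m, ∃ ε > 0, ContDiffOn ℝ n (fun p : ℝ × EuclideanSpace ℝ (Fin 3) => (A m p.1).symm p.2)
          (Icc (t - ε) (t + ε) ×ˢ univ)) ∧
        (∀ t ∉ Ds m, ∀ z, HasDerivAt (fun τ => A m τ z) (Bs m t (A m t z)) t) ∧
        (∀ t z (n : Fin 3 → ℤ), Bs m t (z + latticeVec n) = Bs m t z) ∧
        (∀ a b : ℝ, ∃ C : ℝ, ∀ t ∈ Icc a b, ∀ z, ‖Bs m t z‖ ≤ C) ∧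
        (∀ t ∉ Ds m, ∀ z, ContinuousAt (uncurry (Bs m)) (t, z)) ∧
        (∀ a b : ℝ, ∃ K : ℝ, ∀ t ∈ Icc a b, ∀ z, ‖fderiv ℝ (A m t) z‖ ≤ K) ∧
        (∀ a b : ℝ, ∃ K : ℝ, ∀ t ∈ Icc a b, ∀ z, ‖fderiv ℝ (fun y => (A m t).symm y) z‖ ≤ K)) ∧
      (∀ m t, (∀ z, (fderiv ℝ (A m t) z).det = 1) ∧ ∀ z, (fderiv ℝ (A m t).symm z).det = 1) ∧
      (∀ m t s z, A m (t + E.refresh 1) ((A m (s + E.refresh 1)).symm z) = A m t ((A m s).symm z)) ∧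
      (∀ m t z,
        fderiv ℝ (fun y => A m (t + E.refresh 1) ((A m ((⌊(t + E.refresh 1) / E.refresh (m + 1)⌋ : ℝ) * E.refresh (m + 1))).symm y))
          (A m ((⌊(t + E.refresh 1) / E.refresh (m + 1)⌋ : ℝ) * E.refresh (m + 1)) ((A m (t + E.refresh 1)).symm z))
          (E.toFractalCarrierData.level (m + 1) (t + E.refresh 1)
            (proj (A m ((⌊(t + E.refresh 1) / E.refresh (m + 1)⌋ : ℝ) * E.refresh (m + 1)) ((A m (t + E.refresh 1)).symm z)))) =
        fderiv ℝ (fun y => A m t ((A m ((⌊t / E.refresh (m + 1)⌋ : ℝ) * E.refresh (m + 1))).symm y))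
          (A m ((⌊t / E.refresh (m + 1)⌋ : ℝ) * E.refresh (m + 1)) ((A m t).symm z))
          (E.toFractalCarrierData.level (m + 1) t
            (proj (A m ((⌊t / E.refresh (m + 1)⌋ : ℝ) * E.refresh (m + 1)) ((A m t).symm z))))) := by
  -- the lifted Eulerian level fields and their admissibility
  obtain ⟨v, hv⟩ : ∃ v : ℕ → ℝ → EuclideanSpace ℝ (Fin 3) → EuclideanSpace ℝ (Fin 3),
      ∀ m t z, v m t z = E.toFractalCarrierData.level m t (proj z) := ⟨_, fun _ _ _ => rfl⟩
  have hvU : ∀ m, IsUniformlyLipschitzOn (v m) univ := fun m => by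
    have e : v m = fun t z => E.toFractalCarrierData.level m t (proj z) := funext fun t => funext fun z => hv m t z
    rw [e]; exact isUniformlyLipschitzOn_level_proj _ m
  have hvper : ∀ m t z (n : Fin 3 → ℤ), v m t (z + latticeVec n) = v m t z := fun m t z n => by
    rw [hv, hv, level_proj_add_latticeVec]
  have hvloc : ∀ m (n : ℕ), 1 ≤ n → ∀ r, ∃ ε > 0, ContDiffOn ℝ n (uncurry (v m)) (Icc r (r + ε) ×ˢ univ) ∧
      ContDiffOn ℝ n (uncurry (v m)) (Icc (r - ε) r ×ˢ univ) := fun m n hn r => by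
    have e : v m = fun t z => E.toFractalCarrierData.level m t (proj z) := funext fun t => funext fun z => hv m t z
    rw [e]; exact exists_contDiffOn_slabs_level_proj (n := (n : ℕ∞)) _ m r
  have hvbdd : ∀ m, ∃ C : ℝ, ∀ t z, ‖v m t z‖ ≤ C := fun m =>
    ⟨_, fun t z => by rw [hv]; exact norm_level_proj_le _ m t z⟩
  -- the common period `T = refresh 1`: a whole number of windows of every level, a period of every Eulerian level
  obtain ⟨qf, hqf⟩ : ∃ qf : ℕ → ℕ, ∀ m, E.refresh 1 = (qf m : ℝ) * E.refresh (m + 1) := by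
    have h : ∀ m, ∃ q : ℕ, E.refresh 1 = (q : ℝ) * E.refresh (m + 1) := by
      intro m
      induction m with
      | zero => exact ⟨1, by simp⟩
      | succ n ih =>
        obtain ⟨q, hq⟩ := ih
        obtain ⟨q', -, hq'⟩ := hW2 (n + 1)
        exact ⟨q * q', by rw [hq, hq']; push_cast; ring⟩
    choose qf hqf using h
    exact ⟨qf, hqf⟩
  have hvT : ∀ m t z, v (m + 1) (t + E.refresh 1) z = v (m + 1) t z := by
    intro m t z
    obtain ⟨r, -, hr⟩ := hW1 m
    have hper : Function.Periodic (E.toFractalCarrierData.level (m + 1)) (E.refresh 1) := by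
      rw [hqf m, hr, ← mul_assoc, show ((qf m : ℝ) * (r : ℝ)) = ((qf m * r : ℕ) : ℝ) by push_cast; ring]
      exact (Summit.AnomalousDissipation.AnomalousDissipation.Theorems.SolenoidalFractalHomogenisation.PermissibleCarrier.periodic_level
        E.toFractalCarrierData (m + 1)).nat_mul _
    rw [hv, hv, hper t]
  -- the tower invariant
  let INV : (ℝ → EuclideanSpace ℝ (Fin 3) ≃ EuclideanSpace ℝ (Fin 3)) → (ℝ → EuclideanSpace ℝ (Fin 3) → EuclideanSpace ℝ (Fin 3)) →
      Set ℝ → Prop := fun A B D =>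
    (∀ t z (n : Fin 3 → ℤ), A t (z + latticeVec n) = A t z + latticeVec n) ∧
    (∀ (n : ℕ), 1 ≤ n → ∀ r, ∃ ε > 0, ContDiffOn ℝ n (fun p : ℝ × EuclideanSpace ℝ (Fin 3) => A p.1 p.2) (Icc r (r + ε) ×ˢ univ) ∧
      ContDiffOn ℝ n (fun p : ℝ × EuclideanSpace ℝ (Fin 3) => A p.1 p.2) (Icc (r - ε) r ×ˢ univ)) ∧
    (∀ (n : ℕ), 1 ≤ n → ∀ r, ∃ ε > 0, ContDiffOn ℝ n (fun p : ℝ × EuclideanSpace ℝ (Fin 3) => (A p.1).symm p.2) (Icc r (r + ε) ×ˢ univ) ∧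
      ContDiffOn ℝ n (fun p : ℝ × EuclideanSpace ℝ (Fin 3) => (A p.1).symm p.2) (Icc (r - ε) r ×ˢ univ)) ∧
    D.Countable ∧
    (∀ (n : ℕ), 1 ≤ n → ∀ t ∉ D, ∃ ε > 0, ContDiffOn ℝ n (fun p : ℝ × EuclideanSpace ℝ (Fin 3) => A p.1 p.2) (Icc (t - ε) (t + ε) ×ˢ univ)) ∧
    (∀ (n : ℕ), 1 ≤ n → ∀ t ∉ D, ∃ ε > 0, ContDiffOn ℝ n (fun p : ℝ × EuclideanSpace ℝ (Fin 3) => (A p.1).symm p.2)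
      (Icc (t - ε) (t + ε) ×ˢ univ)) ∧
    (∀ t ∉ D, ∀ z, HasDerivAt (fun τ => A τ z) (B t (A t z)) t) ∧
    (∀ t z (n : Fin 3 → ℤ), B t (z + latticeVec n) = B t z) ∧
    (∀ a b : ℝ, ∃ C : ℝ, ∀ t ∈ Icc a b, ∀ z, ‖B t z‖ ≤ C) ∧
    (∀ t ∉ D, ∀ z, ContinuousAt (uncurry B) (t, z)) ∧
    (∀ a b : ℝ, ∃ K : ℝ, ∀ t ∈ Icc a b, ∀ z, ‖fderiv ℝ (A t) z‖ ≤ K) ∧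
    (∀ a b : ℝ, ∃ K : ℝ, ∀ t ∈ Icc a b, ∀ z, ‖fderiv ℝ (fun y => (A t).symm y) z‖ ≤ K)
  let DET : (ℝ → EuclideanSpace ℝ (Fin 3) ≃ EuclideanSpace ℝ (Fin 3)) → Prop := fun A =>
    (∀ t, (∀ z, (fderiv ℝ (A t) z).det = 1) ∧ ∀ z, (fderiv ℝ (A t).symm z).det = 1) ∧
    ∀ t s z, A (t + E.refresh 1) ((A (s + E.refresh 1)).symm z) = A t ((A s).symm z)
  -- the inserted velocity of level `m+1` over a coarse flow `A`
  let INS : ℕ → (ℝ → EuclideanSpace ℝ (Fin 3) ≃ EuclideanSpace ℝ (Fin 3)) → ℝ → EuclideanSpace ℝ (Fin 3) →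
      EuclideanSpace ℝ (Fin 3) := fun m A t z =>
    fderiv ℝ (fun y => A t ((A ((⌊t / E.refresh (m + 1)⌋ : ℝ) * E.refresh (m + 1))).symm y))
      (A ((⌊t / E.refresh (m + 1)⌋ : ℝ) * E.refresh (m + 1)) ((A t).symm z))
      (v (m + 1) t (A ((⌊t / E.refresh (m + 1)⌋ : ℝ) * E.refresh (m + 1)) ((A t).symm z)))
  have base : INV (fun _ => Equiv.refl _) (fun _ _ => 0) ∅ := by
    refine ⟨fun t z n => rfl, fun n _ r => ⟨1, one_pos, contDiff_snd.contDiffOn, contDiff_snd.contDiffOn⟩,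
      fun n _ r => ⟨1, one_pos, contDiff_snd.contDiffOn, contDiff_snd.contDiffOn⟩, countable_empty,
      fun n _ t _ => ⟨1, one_pos, contDiff_snd.contDiffOn⟩, fun n _ t _ => ⟨1, one_pos, contDiff_snd.contDiffOn⟩,
      fun t _ z => by simpa using hasDerivAt_const t z, fun t z n => rfl, fun a b => ⟨0, fun t _ z => by simp⟩,
      fun t _ z => continuous_const.continuousAt, fun a b => ⟨1, fun t _ z => ?_⟩, fun a b => ⟨1, fun t _ z => ?_⟩⟩
    · simp only [Equiv.coe_refl, fderiv_id]; exact ContinuousLinearMap.norm_id_le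
    · simp only [Equiv.refl_symm, Equiv.coe_refl]
      rw [show (fun y : EuclideanSpace ℝ (Fin 3) => id y) = id from rfl, fderiv_id]; exact ContinuousLinearMap.norm_id_le
  have base' : DET (fun _ => Equiv.refl _) := by
    refine ⟨fun t => ?_, fun t s z => rfl⟩
    constructor <;> intro z <;> simp [ContinuousLinearMap.det]
  -- Liouville for the Eulerian levels
  have hZdet : ∀ m s t (y : EuclideanSpace ℝ (Fin 3)), (fderiv ℝ (evolutionMap (v m) s t) y).det = 1 := fun m s t y => by
    have e : v m = fun t z => E.toFractalCarrierData.level m t (proj z) := funext fun t => funext fun z => hv m t z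
    rw [e]; exact det_fderiv_evolutionMap_level _ m s t y
  have step : ∀ m A B D, INV A B D → DET A → ∃ A' D', INV A' (fun t z => B t z + INS m A t z) D' ∧ DET A' := by
    intro m A B D h hdet'
    obtain ⟨hdet, hper⟩ := hdet'
    obtain ⟨i1, i3, i3', i4, i4a, i4b, i5, i7a, i7b, i7c, i8, i8'⟩ := h
    obtain ⟨Z, hZ, hZ'⟩ := exists_flowEquiv (hvU (m + 1))
    obtain ⟨C, hC0, hC⟩ := exists_int_chain fun j : ℤ => (Z (((j : ℝ) + 1) * E.refresh (m + 1)) ((j : ℝ) * E.refresh (m + 1))).trans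
      ((A ((j : ℝ) * E.refresh (m + 1))).symm.trans (A (((j : ℝ) + 1) * E.refresh (m + 1))))
    refine ⟨_, _, tower_step_explicit A B D i1 i3 i3' i4 i4a i4b i5 i7a i7b i7c i8 i8' (v (m + 1)) (hvU _) (hvper _) (hvloc _)
      (hvbdd _) (E.refresh (m + 1)) (E.refresh_pos _) Z hZ hZ' C hC0 hC _ (fun t => rfl) _ rfl, ?_⟩
    -- unit Jacobians of the next flow
    have hA1 : ∀ t, ContDiff ℝ 1 (A t) ∧ ContDiff ℝ 1 (A t).symm := fun t => by
      obtain ⟨ε, hε, hR1, -⟩ := i3 1 le_rfl t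
      obtain ⟨ε', hε', hR2, -⟩ := i3' 1 le_rfl t
      exact ⟨hR1.comp_contDiff (contDiff_const.prodMk contDiff_id) fun _ => ⟨⟨le_rfl, by linarith⟩, mem_univ _⟩,
        hR2.comp_contDiff (contDiff_const.prodMk contDiff_id) fun _ => ⟨⟨le_rfl, by linarith⟩, mem_univ _⟩⟩
    have hZ1 : ∀ t s, ContDiff ℝ 1 (Z t s) ∧ ContDiff ℝ 1 (Z t s).symm := fun t s => by
      constructor
      · have e : ⇑(Z t s) = evolutionMap (v (m + 1)) s t := funext fun z => hZ t s z
        rw [e]; exact contDiff_evolutionMap_of_local (hvU _) le_rfl (hvloc _ 1 le_rfl) s t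
      · have e : ⇑(Z t s).symm = evolutionMap (v (m + 1)) t s := funext fun z => hZ' t s z
        rw [e]; exact contDiff_evolutionMap_of_local (hvU _) le_rfl (hvloc _ 1 le_rfl) t s
    have hZd : ∀ t s, (∀ z, (fderiv ℝ (Z t s) z).det = 1) ∧ ∀ z, (fderiv ℝ (Z t s).symm z).det = 1 := fun t s => by
      constructor
      · intro z
        have e : ⇑(Z t s) = evolutionMap (v (m + 1)) s t := funext fun z => hZ t s z
        rw [e]; exact hZdet _ _ _ _
      · intro z
        have e : ⇑(Z t s).symm = evolutionMap (v (m + 1)) t s := funext fun z => hZ' t s z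
        rw [e]; exact hZdet _ _ _ _
    have hCd := det_chain C _ hC0 hC (fun j => contDiff_trans (hZ1 _ _) (contDiff_trans (contDiff_symm (hA1 _)) (hA1 _)))
      (fun j => det_trans (hZ1 _ _) (contDiff_trans (contDiff_symm (hA1 _)) (hA1 _)) (hZd _ _)
        (det_trans (contDiff_symm (hA1 _)) (hA1 _) (det_symm (hdet _)) (hdet _)))
    have hCc1 := contDiff_chain C _ hC0 hC fun j => contDiff_trans (hZ1 _ _) (contDiff_trans (contDiff_symm (hA1 _)) (hA1 _))
    refine ⟨fun t => det_window_formula A Z (C ⌊t / E.refresh (m + 1)⌋) hA1 hZ1 (hCc1 _) hdet hZd (hCd _) t _, ?_⟩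
    exact (tower_step_periodic A (v (m + 1)) (hvU _) (E.refresh_pos (m + 1)) (hqf m) hper (hvT m) Z hZ hZ' C hC0 hC _
      (fun t => rfl)).1
  -- the tower
  obtain ⟨A, Bs, Ds, hB0, hBsucc, hINV, hDET⟩ : ∃ (A : ℕ → ℝ → EuclideanSpace ℝ (Fin 3) ≃ EuclideanSpace ℝ (Fin 3))
      (Bs : ℕ → ℝ → EuclideanSpace ℝ (Fin 3) → EuclideanSpace ℝ (Fin 3)) (Ds : ℕ → Set ℝ),
      Bs 0 = (fun _ _ => 0) ∧ (∀ m, Bs (m + 1) = fun t z => Bs m t z + INS m (A m) t z) ∧ (∀ m, INV (A m) (Bs m) (Ds m)) ∧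
      ∀ m, DET (A m) := by
    let T : ℕ → {p : (ℝ → EuclideanSpace ℝ (Fin 3) ≃ EuclideanSpace ℝ (Fin 3)) ×
        (ℝ → EuclideanSpace ℝ (Fin 3) → EuclideanSpace ℝ (Fin 3)) × Set ℝ // INV p.1 p.2.1 p.2.2 ∧ DET p.1} :=
      fun m => Nat.rec ⟨(fun _ => Equiv.refl _, fun _ _ => 0, ∅), base, base'⟩
        (fun m T => ⟨((step m T.1.1 T.1.2.1 T.1.2.2 T.2.1 T.2.2).choose, fun t z => T.1.2.1 t z + INS m T.1.1 t z,
          (step m T.1.1 T.1.2.1 T.1.2.2 T.2.1 T.2.2).choose_spec.choose),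
          (step m T.1.1 T.1.2.1 T.1.2.2 T.2.1 T.2.2).choose_spec.choose_spec⟩) m
    exact ⟨fun m => (T m).1.1, fun m => (T m).1.2.1, fun m => (T m).1.2.2, rfl, fun m => rfl, fun m => (T m).2.1,
      fun m => (T m).2.2⟩
  -- periodicity of the inserted velocities
  have hINSper : ∀ m t z, INS m (A m) (t + E.refresh 1) z = INS m (A m) t z := by
    intro m t z
    obtain ⟨Z, hZ, hZ'⟩ := exists_flowEquiv (hvU (m + 1))
    obtain ⟨C, hC0, hC⟩ := exists_int_chain fun j : ℤ => (Z (((j : ℝ) + 1) * E.refresh (m + 1)) ((j : ℝ) * E.refresh (m + 1))).trans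
      ((A m ((j : ℝ) * E.refresh (m + 1))).symm.trans (A m (((j : ℝ) + 1) * E.refresh (m + 1))))
    exact (tower_step_periodic (A m) (v (m + 1)) (hvU _) (E.refresh_pos (m + 1)) (hqf m) (hDET m).2 (hvT m) Z hZ hZ' C hC0 hC _
      (fun t => rfl)).2 t z
  have hvE : v = fun m t z => E.toFractalCarrierData.level m t (proj z) := funext fun m => funext fun t => funext fun z => hv m t z
  subst hvE
  exact ⟨A, Bs, Ds, hB0, hBsucc, hINV, fun m t => (hDET m).1 t, fun m => (hDET m).2, hINSper⟩

end Summit.AnomalousDissipation.AnomalousDissipation.Theorems.SolenoidalFractalHomogenisation.LagrangianCarrierConstruction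

end
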